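import Mathlib
import Literature.Computability.AlgebraicComplexity.LaurentPolyOrder
import Literature.Computability.AlgebraicComplexity.TraceGadgetTrace
import HarnessLib

/-!
# Andrews 2022, Proposition 2 for `tr(XYZ)`: from the Andrews–Forbes reduction to a border
# computation of `tr(XYZ)` with the same number of multiplications

Topic `Literature/Computability/AlgebraicComplexity`. Eighth support file for the formalisation of
Andrews 2022, Theorem 3 (`DeterminantalIdealComplexity.lean`). Andrews' Proposition 2: for a
nonzero `f ∈ I^det_{n,m,r}`, an oracle for `f` (border-)computes every polynomial in the border of
layered trace ABPs with `≤ r` vertices; its proof composes Proposition 1 (= Andrews–Forbes 2022,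
Prop. 3.5, the tree's named fact `AndrewsForbes2022_prop_3_5`) with the gadget of Lemma 8
(`TraceGadgetMatrix/Trace.lean`) and the substitution "`ε ↦ ε²`, `δ ↦ ε`", and divides by
`ε^{2q+1} α`. We carry this out for `tr(XYZ)` (`X, Y, Z` of size `t × t`, `4t ≤ r`) in the
currency of nonscalar computation sequences over `F((ε))` (`NonscalarComputation.lean`):

* `laurentForm` — the conclusion of Andrews–Forbes Prop. 3.5, pushed from `F(ε)` into `F((ε))`
  and through `ε ↦ ε²`: `f(ℓ(X)) = ε^{2q} α · (K_σ|K_σ)(X) + O(ε^{2q+2})` coefficientwise.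
* `aeval_gad_kBideterminant` — substituting the gadget into `(K_σ|K_σ)(X) = ∏ᵢ det X_{[σᵢ]}`
  gives the product of the leading minors of the gadget (`TraceGadget.M`).
* `prod_det_M_laurent` — Lemma 8 over `F((ε))` with an `O(1)` remainder (Lemma 8 is applied over
  `F[δ]` and mapped along `F[δ] → F⟦ε⟧ ⊆ F((ε))`).
* `exists_seq_traceXYZ` — **Prop. 2 + multiplication count**: from the data of Prop. 3.5 for a
  nonzero `f`, there is a nonscalar computation sequence over `F((ε))` of length
  `≤ complexity f` whose cost-free span contains `tr(XYZ) + E` with `E = O(ε)` coefficientwise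
  (the circuit for `f` over `F` is base-changed to `F((ε))` and fed the affine-linear forms
  `ℓ_{ij}(M(Z), ε²)`; affine substitutions are free, `IsNonscalarSeq.aeval_append`).

Everything here is over a field `F : Type` of characteristic zero (the universe of the tree's
`AndrewsForbes2022_prop_3_5`).

## References

* [Andrews2022] R. Andrews, FOCS 2022, arXiv:2208.01078, Prop. 1, Lemma 8, Prop. 2 and its proof,
  proof of Thm. 3.
* [AndrewsForbes2022] R. Andrews, M. A. Forbes, STOC 2022, arXiv:2112.00792, Prop. 3.5.
-/

noncomputable section

open MvPolynomial
open scoped RatFunc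

namespace Literature.Computability.AlgebraicComplexity

namespace Andrews2022Proof

universe v

variable {F : Type} [Field F]

/-- Notation-free abbreviation: `ε = single 1 1 ∈ F((ε))`. [folklore] -/
abbrev eps (F : Type) [Field F] : LaurentSeries F := HahnSeries.single 1 1

/-! ### Step 1–2: the Andrews–Forbes identity in `F((ε))`, after `ε ↦ ε²` -/

/-- The linear forms `ℓ_{ij} = Σ_{kl} c_{ij,kl} x_{kl}` of Prop. 3.5, with coefficients pushed into
`F((ε))` along a ring hom `φ : F(ε) → F((ε))`. [cite: AndrewsForbes2022, Prop. 3.5] -/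
def linForms {n m : ℕ} (φ : RatFunc F →+* LaurentSeries F)
    (c : Matrix (Fin n × Fin m) (Fin n × Fin m) (RatFunc F)) (ij : Fin n × Fin m) :
    MvPolynomial (Fin n × Fin m) (LaurentSeries F) :=
  ∑ kl, C (φ (c ij kl)) * X kl

/-- The linear forms are affine-linear, i.e. cost-free: members of `freeSpan ∅`. [folklore] -/
theorem linForms_mem_freeSpan {n m : ℕ} (φ : RatFunc F →+* LaurentSeries F)
    (c : Matrix (Fin n × Fin m) (Fin n × Fin m) (RatFunc F)) (ij : Fin n × Fin m) :
    linForms φ c ij ∈ freeSpan (∅ : Set (MvPolynomial (Fin n × Fin m) (LaurentSeries F))) := by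
  unfold linForms
  refine Submodule.sum_mem _ fun kl _ => ?_
  rw [← smul_eq_C_mul]
  exact Submodule.smul_mem _ _ (X_mem_freeSpan _ kl)

/-- `aeval` of an `F`-polynomial by forms over an `F`-algebra `K` is `bind₁` of its base change.
[folklore] -/
theorem aeval_eq_bind₁_map {K : Type} [CommRing K] [Algebra F K] {σ τ : Type}
    (g : σ → MvPolynomial τ K) (p : MvPolynomial σ F) :
    aeval g p = bind₁ g (MvPolynomial.map (algebraMap F K) p) := by
  rw [← aeval_eq_bind₁, aeval_map_algebraMap]

/-- **Prop. 3.5 in `F((ε))` after `ε ↦ ε²`.** From the conclusion of `AndrewsForbes2022_prop_3_5`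
for `f` (coefficientwise `f(ℓ(X)) - ε^q α (K_σ|K_σ)(X) = O(ε^{q+1})` in `F(ε)`): with
`φ = sqEps ∘ (F(ε) → F((ε)))`, the polynomial `f(ℓ^φ(X)) - ε^{2q} α (K_σ|K_σ)(X)` has all
coefficients `O(ε^{2q+2})` in `F((ε))`. [cite: Andrews2022, Prop. 2 (proof)] -/
theorem laurentForm {n m : ℕ} (f : MvPolynomial (Fin n × Fin m) F)
    (c : Matrix (Fin n × Fin m) (Fin n × Fin m) (RatFunc F)) (q : ℤ) (α : F) (σ : Multiset ℕ)
    (h : ∀ e : (Fin n × Fin m) →₀ ℕ, IsBigOEps F (q + 1) (coeff e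
      (aeval (fun ij : Fin n × Fin m => ∑ kl : Fin n × Fin m, C (c ij kl) * X kl) f -
        C (RatFunc.X ^ q * algebraMap F (RatFunc F) α) *
          MvPolynomial.map (algebraMap F (RatFunc F)) (kBideterminant F n m σ)))) :
    PolyOrdGE (2 * q + 2)
      (bind₁ (linForms (sqEps.comp (algebraMap (RatFunc F) (LaurentSeries F))) c)
          (MvPolynomial.map (algebraMap F (LaurentSeries F)) f) -
        C (HahnSeries.single (2 * q) α) *
          MvPolynomial.map (algebraMap F (LaurentSeries F)) (kBideterminant F n m σ)) := by
  set ι : RatFunc F →+* LaurentSeries F := algebraMap (RatFunc F) (LaurentSeries F) with hι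
  set φ : RatFunc F →+* LaurentSeries F := sqEps.comp ι with hφ
  set D := aeval (fun ij : Fin n × Fin m => ∑ kl : Fin n × Fin m, C (c ij kl) * X kl) f -
      C (RatFunc.X ^ q * algebraMap F (RatFunc F) α) *
        MvPolynomial.map (algebraMap F (RatFunc F)) (kBideterminant F n m σ) with hD
  -- coefficientwise: `O(ε^{q+1})` in `F((ε))`, then `O(ε^{2q+2})` after `ε ↦ ε²`
  have hD1 : PolyOrdGE (q + 1) (MvPolynomial.map ι D) := fun e => by
    rw [coeff_map]
    exact (isBigOEps_iff_isOrdGE _ _).1 (h e)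
  have hD2 : PolyOrdGE (2 * q + 2) (MvPolynomial.map φ D) := by
    rw [hφ, ← MvPolynomial.map_map, show 2 * q + 2 = 2 * (q + 1) by ring]
    exact hD1.map_sqEps
  -- identify `map φ D`
  have hφF : φ.comp (algebraMap F (RatFunc F)) = algebraMap F (LaurentSeries F) := by
    rw [hφ, RingHom.comp_assoc, hι, algebraMap_ratFunc_comp_algebraMap, sqEps_comp_algebraMap]
  have hmapf : ∀ p : MvPolynomial (Fin n × Fin m) F,
      MvPolynomial.map φ (MvPolynomial.map (algebraMap F (RatFunc F)) p) =
        MvPolynomial.map (algebraMap F (LaurentSeries F)) p := fun p => by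
    rw [MvPolynomial.map_map, hφF]
  have hconst : φ (RatFunc.X ^ q * algebraMap F (RatFunc F) α) = HahnSeries.single (2 * q) α := by
    rw [map_mul, hφ, RingHom.comp_apply, RingHom.comp_apply, hι]
    change sqEps (((RatFunc.X ^ q : RatFunc F) : LaurentSeries F)) *
      sqEps (((algebraMap F (RatFunc F) α : RatFunc F) : LaurentSeries F)) = _
    rw [coe_ratFunc_X_zpow, coe_ratFunc_algebraMap, sqEps_single, sqEps_C, HahnSeries.C_apply,
      HahnSeries.single_mul_single, add_zero, one_mul]
  have hlin : (fun ij : Fin n × Fin m =>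
      MvPolynomial.map φ (∑ kl : Fin n × Fin m, C (c ij kl) * X kl)) = linForms φ c := by
    funext ij
    simp [linForms, map_sum]
  have key : MvPolynomial.map φ D =
      bind₁ (linForms φ c) (MvPolynomial.map (algebraMap F (LaurentSeries F)) f) -
        C (HahnSeries.single (2 * q) α) *
          MvPolynomial.map (algebraMap F (LaurentSeries F)) (kBideterminant F n m σ) := by
    rw [hD, map_sub, map_mul, map_C, hconst, hmapf, aeval_eq_bind₁_map, map_bind₁, hmapf, hlin]
  rw [← key]
  exact hD2

/-! ### Step 3: the gadget inside the bideterminant, and Lemma 8 over `F((ε))` -/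

/-- The gadget entries are affine-linear (cost-free). [cite: Andrews2022, Lemma 8] -/
theorem gad_mem_freeSpan {S : Type} [CommRing S] (t : ℕ) [NeZero t] (cS : Fin t → S) (δ : S)
    (x y : ℕ) : TraceGadget.gad t cS δ x y ∈
      freeSpan (∅ : Set (MvPolynomial (TraceGadget.Var t) S)) := by
  unfold TraceGadget.gad TraceGadget.upper TraceGadget.lab TraceGadget.feedback
  refine add_mem (add_mem ?_ ?_) ?_
  · split_ifs
    · exact one_mem_freeSpan _
    · exact zero_mem _
  · split_ifs
    · rw [← smul_eq_C_mul]
      exact Submodule.smul_mem _ _ (X_mem_freeSpan _ _)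
    · exact X_mem_freeSpan _ _
    · exact X_mem_freeSpan _ _
    · exact zero_mem _
  · split_ifs
    · rw [mul_one]
      exact C_mem_freeSpan _ _
    · rw [mul_zero]
      exact zero_mem _

/-- The gadget entries over `F((ε))` are `O(1)` when the constants are. [cite: Andrews2022, Lemma 8] -/
theorem polyOrdGE_gad (t : ℕ) [NeZero t] {cL : Fin t → LaurentSeries F}
    (hc : ∀ i, IsOrdGE 0 (cL i)) (x y : ℕ) : PolyOrdGE 0 (TraceGadget.gad t cL (eps F) x y) := by
  unfold TraceGadget.gad TraceGadget.upper TraceGadget.lab TraceGadget.feedback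
  refine PolyOrdGE.add (PolyOrdGE.add ?_ ?_) ?_
  · split_ifs
    · exact PolyOrdGE.one
    · exact PolyOrdGE.zero 0
  · split_ifs
    · simpa using (PolyOrdGE.C (hc _)).mul (PolyOrdGE.X (F := F) _)
    · exact PolyOrdGE.X _
    · exact PolyOrdGE.X _
    · exact PolyOrdGE.zero 0
  · have hε : PolyOrdGE 0 (C (eps F) : MvPolynomial (TraceGadget.Var t) (LaurentSeries F)) :=
      PolyOrdGE.C ((IsOrdGE.single 1 (1 : F)).mono (by norm_num))
    split_ifs
    · rw [mul_one]
      exact hε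
    · rw [mul_zero]
      exact PolyOrdGE.zero 0

/-- **The gadget inside the bideterminant**: substituting `x_{ij} ↦ M'_{ij}` into
`(K_σ|K_σ)(X) = ∏ᵢ det X_{[σᵢ],[σᵢ]}` (all parts `≤ min(n,m)`) yields the product of the leading
minors of the gadget. [cite: Andrews2022, Prop. 2 (proof)] -/
theorem aeval_gad_kBideterminant {S : Type} [CommRing S] [Algebra F S] (t : ℕ) [NeZero t]
    (cS : Fin t → S) (δ : S) {n m : ℕ} (σ : Multiset ℕ) (hσ : ∀ s ∈ σ, s ≤ n ∧ s ≤ m) :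
    aeval (fun ij : Fin n × Fin m => TraceGadget.gad t cS δ (ij.1 : ℕ) (ij.2 : ℕ))
        (kBideterminant F n m σ) =
      (σ.map fun s => (TraceGadget.M t cS δ s).det).prod := by
  rw [kBideterminant, map_multiset_prod, Multiset.map_map]
  refine congrArg Multiset.prod (Multiset.map_congr rfl fun s hs => ?_)
  obtain ⟨hn, hm⟩ := hσ s hs
  rw [Function.comp_apply, leadingMinor_of_le hn hm, AlgHom.map_det, AlgHom.mapMatrix_apply]
  congr 1
  ext x y
  simp [TraceGadget.M, Matrix.mvPolynomialX_apply]

/-- The ring hom `F[δ] → F((ε))`, `δ ↦ ε` (through power series). [folklore] -/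
def polyToLaurent (F : Type) [Field F] : Polynomial F →+* LaurentSeries F :=
  (HahnSeries.ofPowerSeries ℤ F).comp (Polynomial.coeToPowerSeries.ringHom (R := F))

/-- `polyToLaurent` on constants. [folklore] -/
@[simp] theorem polyToLaurent_C (a : F) : polyToLaurent F (Polynomial.C a) = HahnSeries.C a := by
  simp [polyToLaurent, Polynomial.coe_C]

/-- `polyToLaurent δ = ε`. [folklore] -/
@[simp] theorem polyToLaurent_X : polyToLaurent F Polynomial.X = eps F := by
  simp [polyToLaurent, Polynomial.coe_X]

/-- Images of `polyToLaurent` are power series, hence `O(1)`. [folklore] -/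
theorem isOrdGE_polyToLaurent (p : Polynomial F) : IsOrdGE 0 (polyToLaurent F p) :=
  IsOrdGE.ofPowerSeries _

/-- **Lemma 8 over `F((ε))` with an `O(1)` remainder.** With the rescaling constants
`cᵢ = -1/Nᵢ` (`Nᵢ = #{s ∈ σ : 3t + i < s} ≥ 1`), the product of the leading minors of the gadget
with `δ = ε` is `1 + ε tr(XYZ) + ε² R` with `R = O(1)` coefficientwise.
[cite: Andrews2022, Lemma 8] -/
theorem prod_det_M_laurent [CharZero F] (t : ℕ) [NeZero t] (σ : Multiset ℕ)
    (hN : ∀ i : Fin t, 0 < (σ.filter fun s => (i : ℕ) + 3 * t < s).card) :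
    ∃ R : MvPolynomial (TraceGadget.Var t) (LaurentSeries F), PolyOrdGE 0 R ∧
      (σ.map fun s => (TraceGadget.M t
        (fun i => HahnSeries.C (-((σ.filter fun s => (i : ℕ) + 3 * t < s).card : F)⁻¹))
        (eps F) s).det).prod =
      1 + C (eps F) * TraceGadget.traceXYZ (LaurentSeries F) t + C (eps F) ^ 2 * R := by
  set cP : Fin t → Polynomial F :=
    fun i => Polynomial.C (-((σ.filter fun s => (i : ℕ) + 3 * t < s).card : F)⁻¹) with hcP
  have hc : ∀ i : Fin t,
      ((σ.filter fun s => (i : ℕ) + 3 * t < s).card : Polynomial F) * cP i = -1 := by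
    intro i
    have hNi : ((σ.filter fun s => (i : ℕ) + 3 * t < s).card : F) ≠ 0 := by
      exact_mod_cast (hN i).ne'
    rw [hcP, ← Polynomial.C_eq_natCast, ← Polynomial.C_mul, mul_neg, mul_inv_cancel₀ hNi,
      Polynomial.C_neg, Polynomial.C_1]
  obtain ⟨RP, hRP⟩ := TraceGadget.prod_det_M (S := Polynomial F) (t := t) (c := cP)
    (δ := Polynomial.X) σ hc
  refine ⟨MvPolynomial.map (polyToLaurent F) RP, fun e => ?_, ?_⟩
  · rw [coeff_map]
    exact isOrdGE_polyToLaurent _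
  · have hmap := congrArg (MvPolynomial.map (polyToLaurent F)) hRP
    have hcomp : (⇑(polyToLaurent F) ∘ cP) = fun i : Fin t =>
        (HahnSeries.C (-((σ.filter fun s => (i : ℕ) + 3 * t < s).card : F)⁻¹) :
          LaurentSeries F) := by
      funext i
      rw [Function.comp_apply, hcP, polyToLaurent_C]
    rw [TraceGadget.map_prod_det_M, map_add, map_add, map_mul, map_mul, map_pow, map_C, map_one,
      TraceGadget.map_traceXYZ, polyToLaurent_X, hcomp] at hmap
    exact hmap

/-! ### Step 4–5: `tr(XYZ) + O(ε)` in the cost-free span of a short computation sequence -/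

/-- **Andrews 2022, Prop. 2 for `tr(XYZ)`, with the multiplication count of the proof of
Theorem 3.** Let `f ∈ F[X_{n×m}]` and suppose the conclusion of Andrews–Forbes Prop. 3.5 holds
for `f` with data `c, q, α ≠ 0, σ` (all parts `≤ min(n,m)`), and let `t ≥ 1` with
`#{s ∈ σ : 3t + i < s} ≥ 1` for all `i < t` (e.g. `4t ≤ max σ`). Then there is a nonscalar
computation sequence over `F((ε))` of length `≤ complexity f` whose cost-free span contains
`tr(XYZ) + E` for some `E` with `O(ε)` coefficients: the circuit for `f`, base-changed to `F((ε))`,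
fed the cost-free forms `ℓ_{ij}(M'(X,Y,Z))` (with `ε ↦ ε²` in `ℓ`), shifted by `-ε^{2q} α` and
divided by `ε^{2q+1} α`. [cite: Andrews2022, Prop. 2 and proof of Thm. 3] -/
theorem exists_seq_traceXYZ [CharZero F] {n m : ℕ} (f : MvPolynomial (Fin n × Fin m) F)
    (c : Matrix (Fin n × Fin m) (Fin n × Fin m) (RatFunc F)) (q : ℤ) {α : F} (hα : α ≠ 0)
    (σ : Multiset ℕ) (hσ : ∀ s ∈ σ, s ≤ n ∧ s ≤ m) (t : ℕ) [NeZero t]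
    (hN : ∀ i : Fin t, 0 < (σ.filter fun s => (i : ℕ) + 3 * t < s).card)
    (h : ∀ e : (Fin n × Fin m) →₀ ℕ, IsBigOEps F (q + 1) (coeff e
      (aeval (fun ij : Fin n × Fin m => ∑ kl : Fin n × Fin m, C (c ij kl) * X kl) f -
        C (RatFunc.X ^ q * algebraMap F (RatFunc F) α) *
          MvPolynomial.map (algebraMap F (RatFunc F)) (kBideterminant F n m σ)))) :
    ∃ gs : List (MvPolynomial (TraceGadget.Var t) (LaurentSeries F)),
      IsNonscalarSeq gs ∧ gs.length ≤ complexity f ∧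
      ∃ E : MvPolynomial (TraceGadget.Var t) (LaurentSeries F), PolyOrdGE 1 E ∧
        TraceGadget.traceXYZ (LaurentSeries F) t + E ∈ freeSpan {x | x ∈ gs} := by
  classical
  -- notation
  set L := LaurentSeries F
  set φ : RatFunc F →+* LaurentSeries F := sqEps.comp (algebraMap (RatFunc F) (LaurentSeries F))
  set fL : MvPolynomial (Fin n × Fin m) L := MvPolynomial.map (algebraMap F L) f with hfL
  set KσL : MvPolynomial (Fin n × Fin m) L :=
    MvPolynomial.map (algebraMap F L) (kBideterminant F n m σ) with hKσL
  set cL : Fin t → L :=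
    fun i => HahnSeries.C (-((σ.filter fun s => (i : ℕ) + 3 * t < s).card : F)⁻¹) with hcL
  set ψ : Fin n × Fin m → MvPolynomial (TraceGadget.Var t) L :=
    fun ij => TraceGadget.gad t cL (eps F) (ij.1 : ℕ) (ij.2 : ℕ) with hψ
  set T : MvPolynomial (TraceGadget.Var t) L := TraceGadget.traceXYZ L t with hT
  -- Step 1–2
  have h12 := laurentForm f c q α σ h
  set D₂ := bind₁ (linForms φ c) fL - C (HahnSeries.single (2 * q) α) * KσL with hD₂
  -- Step 3
  have hcL0 : ∀ i, IsOrdGE 0 (cL i) := fun i => IsOrdGE.C _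
  have hψ0 : ∀ ij, PolyOrdGE 0 (ψ ij) := fun ij => polyOrdGE_gad t hcL0 _ _
  have hψK : bind₁ ψ KσL = (σ.map fun s => (TraceGadget.M t cL (eps F) s).det).prod := by
    rw [hKσL, ← aeval_eq_bind₁_map]
    exact aeval_gad_kBideterminant t cL (eps F) σ hσ
  obtain ⟨R, hR0, hR⟩ := prod_det_M_laurent (F := F) t σ hN
  -- Step 4: the polynomial `G = f(ℓ(M'))` and `g̃ = (G - ε^{2q} α)/(ε^{2q+1} α) = T + E`
  set G := bind₁ ψ (bind₁ (linForms φ c) fL) with hG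
  set u : L := HahnSeries.single (2 * q + 1) α with hu
  set E : MvPolynomial (TraceGadget.Var t) L :=
    C (eps F) * R + C u⁻¹ * bind₁ ψ D₂ with hE
  have hE1 : PolyOrdGE 1 E := by
    refine PolyOrdGE.add ?_ ?_
    · simpa using (PolyOrdGE.C ((IsOrdGE.single 1 (1 : F)))).mul hR0
    · have hu' : IsOrdGE (-(2 * q + 1)) u⁻¹ := by
        rw [hu, HahnSeries.inv_single]
        exact IsOrdGE.single _ _
      have := (PolyOrdGE.C hu').mul (h12.bind₁ hψ0)
      rw [show -(2 * q + 1) + (2 * q + 2) = 1 by ring] at this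
      exact this
  have hGE : C u⁻¹ * (G - C (HahnSeries.single (2 * q) α)) = T + E := by
    -- `G = C(single 2q α) * (1 + ε T + ε² R) + bind₁ ψ D₂`
    have hG' : G = C (HahnSeries.single (2 * q) α) * (1 + C (eps F) * T + C (eps F) ^ 2 * R) +
        bind₁ ψ D₂ := by
      rw [hG, hD₂, map_sub, map_mul, bind₁_C_right, hψK, hR]
      ring
    have hu1 : u⁻¹ * (HahnSeries.single (2 * q) α * eps F) = 1 := by
      rw [hu, HahnSeries.single_mul_single, mul_one, inv_mul_cancel₀]
      exact fun h0 => hα (HahnSeries.single_eq_zero_iff.1 h0)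
    have hu2 : u⁻¹ * (HahnSeries.single (2 * q) α * (eps F) ^ 2) = eps F := by
      rw [pow_two, ← mul_assoc (HahnSeries.single (2 * q) α), ← mul_assoc, hu1, one_mul]
    rw [hG', hE]
    have eC : ∀ a b : L, (C a : MvPolynomial (TraceGadget.Var t) L) * C b = C (a * b) :=
      fun a b => (map_mul C a b).symm
    -- expand and collect the constants
    have : C u⁻¹ * (C (HahnSeries.single (2 * q) α) * (1 + C (eps F) * T + C (eps F) ^ 2 * R) +
          bind₁ ψ D₂ - C (HahnSeries.single (2 * q) α)) =
        C (u⁻¹ * (HahnSeries.single (2 * q) α * eps F)) * T +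
          (C (u⁻¹ * (HahnSeries.single (2 * q) α * eps F ^ 2)) * R + C u⁻¹ * bind₁ ψ D₂) := by
      simp only [map_mul, map_pow]
      ring
    rw [this, hu1, hu2, C_1, one_mul]
  -- Step 5: the computation sequence
  obtain ⟨gsF, hgsF, hlenF, hfmem⟩ := exists_isNonscalarSeq_length_le_complexity f
  set Θ : Fin n × Fin m → MvPolynomial (TraceGadget.Var t) L :=
    fun ij => bind₁ ψ (linForms φ c ij) with hΘ
  have hΘfree : ∀ ij, Θ ij ∈ freeSpan {x | x ∈ ([] : List (MvPolynomial (TraceGadget.Var t) L))} := by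
    intro ij
    have he : {x | x ∈ ([] : List (MvPolynomial (TraceGadget.Var t) L))} = ∅ := by
      ext x
      simp
    rw [he, hΘ]
    simp only [linForms, map_sum, map_mul, bind₁_C_right, bind₁_X_right]
    refine Submodule.sum_mem _ fun kl _ => ?_
    rw [← smul_eq_C_mul]
    exact Submodule.smul_mem _ _ (gad_mem_freeSpan t cL (eps F) _ _)
  obtain ⟨hseq, hspan⟩ := IsNonscalarSeq.aeval_append hΘfree isNonscalarSeq_nil
    (hgsF.map (algebraMap F L))
  refine ⟨(gsF.map (MvPolynomial.map (algebraMap F L))).map (aeval Θ) ++ [], hseq,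
    by simpa using hlenF, E, hE1, ?_⟩
  have hGmem : G ∈ freeSpan {x | x ∈ (gsF.map (MvPolynomial.map (algebraMap F L))).map
      (aeval Θ) ++ []} := by
    have hG2 : G = aeval Θ fL := by
      rw [hG, aeval_eq_bind₁, bind₁_bind₁]
    rw [hG2, hfL]
    exact hspan _ (map_mem_freeSpan_map (algebraMap F L) hfmem)
  rw [← hGE, mul_sub, ← map_mul, ← smul_eq_C_mul]
  exact sub_mem (Submodule.smul_mem _ _ hGmem) (C_mem_freeSpan _ _)

end Andrews2022Proof

end Literature.Computability.AlgebraicComplexity
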